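import Summits.QuantumFields.BalabanUV.T4Continuum.Support.UrsellSeriesBound
import Summits.QuantumFields.BalabanUV.T4Continuum.Support.B13StepTermSocket
import Summits.QuantumFields.BalabanUV.T4Continuum.Support.B13TermRep

/-!
# NE5 ∕ U3 — convergence of the ORDERED series (2.13), part 3: the COMBINATORIAL CONVERGENCE binder of row O1-d3 DISCHARGED
# for the socket instance on Bałaban's term labels, from an activity-level anchored exponential norm

Cell `pub-balaban`, unit `b2b-balaban-t4-ne5-formalise-leaf-08` (NE5 formalisation swarm, LEAF PROVER 08; row O1-d2 follower (iii),
journal INTENT l.6289; parts 1–2 = `Support/UrsellTreeSum` p208810, `Support/UrsellSeriesBound` p209076).  Summits-side NEW WORK under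
the LEAN PLACEMENT RULE (cell bookkeeping).  HONEST FRAMING: rung (B)+1 of the FINITE-VOLUME T⁴ continuum programme — NOT infinite
volume, NOT a mass gap, NOT the Clay problem, NOT a proof of NE5.  HONEST DEPENDENCY (cell line, verbatim): continuum YM on T⁴ ⇐
BetaPertH ∧ nine spine estimates (0/9 proved); BetaPertH ⇐ (D1) ∧ (D4) ∧ CAP+tail; G-an2-4 gates asym, D1 and NE2/3/4.

WHAT.  Row O1-d3 for the B13 term family (`B13TermRep.termRep_b13_of_actBound` ∕ `classBound_b13_of_actBound`, leaf-04 p208307)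
displays two binders: (i) an ACTIVITY MAJORANT `A Z ℓ` of the resummed (2.14)-terms at class points (the SHAPE of
[Balaban1988RG2Cluster] Lemma 3 (2.38) p. 20 — kept displayed here, c3) and (ii) the COMBINATORIAL CONVERGENCE
`Summable (actMajorant 𝒯 inc A k X)` with a per-domain budget `∑' ≤ …` (the SHAPE of p. 20's *"sufficient conditions for
convergence of the series (2.12), (2.13) are satisfied, see [26, 67, 25, 50]"*).  For the socket instance on leaf-02's labels
(`B13StepTermSocket.labelsIndexing G D`, hard core `touchInc G`, p208148) THIS FILE PROVES (ii) from (i)'s activity-LEVEL norm: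
with `actSum A k Z := Σ_{ℓ ∈ innerLabels D k Z} A Z ℓ` (the majorant of the WHOLE activity `H(Z)`), a footprint-local reach
(`#reach ≤ ν·#cubes`, as in `B13Resummation.kp_condition`) and the ANCHORED EXPONENTIAL NORM on the step-`k` catalogue
`Σ_{Z ∈ level k, Z ∋ q} actSum(Z)·e^{#cubes Z} ≤ Φ` with `4νΦ < 1`:
* `level_eq` — at a step-`k` domain `X` the level-`n` sum of `actMajorant` over the localizing labels IS the (2.13)∘(2.9) sum
  `Σ_{Z⃗ covers X} (|ρᵀ(Z⃗)|/(n+1)!)·Π_m actSum(Z_m)` (leaf-02's `sum_termLabels_eq_sum_polyTuples`, BY NAME, real form);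
* `level_le` — `≤ levelMajorant ν Φ n = Φ·(4νΦ)^n`: every tuple covering `X` has a member containing a fixed cube `q₀` of `X`, so the
  sum is dominated by the `n+1` anchored sums of part 2 (`UrsellSeriesBound.sum_abs_rhoT_prod_le`, on the finite catalogue `↥(level k)`);
* **`summable_actMajorant`** and **`tsum_actMajorant_le`** (`∑' ≤ Φ/(1 − 4νΦ)`): binder (ii) of row O1-d3 as a THEOREM (decay rate
  `κ = 0`; the extraction of `e^{−κ d(X)}` along (2.27)∕(2.39)–(2.41) is a separate, displayed geometric step — not here);
* §4 plugs them into leaf-04 BY NAME: `termRep_b13_of_actNorm` (`TermRep`) and `classBound_b13_of_actNorm` (`ClassBound M K W 0 _`).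
Nothing of the manuscripts under audit is asserted ([II] cited for FORM∕locus).  0 sorry; axioms ⊆ {propext, Classical.choice, Quot.sound}.
-/

noncomputable section

open Finset
open scoped BigOperators

namespace Summit.QuantumFields.BalabanUV.T4Continuum.UrsellTermBudget

open Literature.MathematicalPhysics.QuantumFieldTheory.Balaban1983to89.T4OutputRate (Carriers)
open Summit.QuantumFields.BalabanUV.T4Continuum.ClusterRepOfDomains (DomainGeometry)
open Summit.QuantumFields.BalabanUV.T4Continuum.B13StepTermLabels
open Summit.QuantumFields.BalabanUV.T4Continuum.B13StepTermSocket (labelsIndexing touchInc rel_iff)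
open Summit.QuantumFields.BalabanUV.T4Continuum.B13TermRep (actMajorant actMajorant_of_rel actMajorant_of_not_rel
  actMajorant_nonneg)
open Summit.QuantumFields.BalabanUV.T4Continuum.UrsellTreeSum (ind ind_nonneg ind_le_one ind_of_pos ind_of_neg)
open Summit.QuantumFields.BalabanUV.T4Continuum.UrsellSeriesBound (sum_abs_rhoT_prod_le levelMajorant levelMajorant_nonneg
  summable_levelMajorant tsum_levelMajorant)

variable {C : Carriers} [DecidableEq C.Dom] {Cube : Type*} [DecidableEq Cube] {Bnd : Type*} [DecidableEq Bnd]
  (G : DomainGeometry C Cube) (D : InnerData C Bnd) (A : C.Dom → InnerLabel C.Dom Bnd → ℝ)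

/-! ## §1 The activity-level majorant and the level identity -/

/-- [folklore] THE MAJORANT OF THE WHOLE ACTIVITY `H(Z) = Σ_ℓ term_ℓ(Z)` at step `k`: `Σ_{ℓ ∈ innerLabels D k Z} A Z ℓ`. -/
def actSum (k : ℕ) (Z : C.Dom) : ℝ := ∑ ℓ ∈ innerLabels D k Z, A Z ℓ

omit [DecidableEq Cube] in
/-- [folklore] The activity majorant is nonnegative for nonnegative term majorants. -/
theorem actSum_nonneg (hA : ∀ Z ℓ, 0 ≤ A Z ℓ) (k : ℕ) (Z : C.Dom) : 0 ≤ actSum D A k Z :=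
  sum_nonneg fun _ _ => hA _ _

/-- [folklore] A Mathlib-style transfer along an injection with nonnegative surplus (local copy of a standard lemma). -/
theorem sum_le_sum_of_injOn_real {α β : Type*} [DecidableEq β] {s : Finset α} {t : Finset β} (e : α → β)
    (he : Set.InjOn e s) (hst : ∀ a ∈ s, e a ∈ t) {f : α → ℝ} {g : β → ℝ} (hg : ∀ b ∈ t, 0 ≤ g b)
    (hfg : ∀ a ∈ s, f a ≤ g (e a)) : ∑ a ∈ s, f a ≤ ∑ b ∈ t, g b :=
  calc ∑ a ∈ s, f a ≤ ∑ a ∈ s, g (e a) := sum_le_sum hfg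
    _ = ∑ b ∈ s.image e, g b := (sum_image he).symm
    _ ≤ ∑ b ∈ t, g b :=
        sum_le_sum_of_subset_of_nonneg (fun b hb => by obtain ⟨a, ha, rfl⟩ := mem_image.1 hb; exact hst a ha)
          fun b hb _ => hg b hb

/-- [folklore] The coefficient norm of a label depends on its polymer tuple only: `‖coeff ⟨n, t⟩‖ = |ρᵀ(polys)|/(n+1)!`. -/
theorem norm_coeff_eq {n : ℕ} (t : Fin (n + 1) → PolyLabel C.Dom Bnd) :
    ‖B13StepTermFamily.coeff (labelsIndexing G D) (touchInc G) (⟨n, t⟩ : TermIdx C.Dom Bnd)‖ =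
      |(B13StepTermFamily.rhoT (touchInc G) (fun i => (t i).Z) : ℝ)| / ((n + 1).factorial : ℝ) := by
  unfold B13StepTermFamily.coeff
  rw [norm_mul, norm_inv, Complex.norm_natCast, Complex.norm_intCast, div_eq_inv_mul]
  rfl

/-- [folklore] **THE LEVEL IDENTITY**: at a step-`k` domain `X`, the level-`n` sum of leaf-04's `actMajorant` over the labels
localizing at `X` is the (2.13)∘(2.9) sum over the polymer tuples covering `X` of `(|ρᵀ|/(n+1)!)·Π_m actSum(Z_m)` (leaf-02's
`sum_termLabels_eq_sum_polyTuples` in real form). -/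
theorem level_eq {k : ℕ} {X : C.Dom} (hX : C.scale X = k) (n : ℕ) :
    ∑ t ∈ termLabels G D k X n, actMajorant (labelsIndexing G D) (touchInc G) A k X ⟨n, t⟩ =
      ∑ Z ∈ polyTuples G k X n, |(B13StepTermFamily.rhoT (touchInc G) Z : ℝ)| / ((n + 1).factorial : ℝ) *
        ∏ m, actSum D A k (Z m) := by
  have h := sum_termLabels_eq_sum_polyTuples G D k X n
    (fun Z => ((|(B13StepTermFamily.rhoT (touchInc G) Z : ℝ)| / ((n + 1).factorial : ℝ) : ℝ) : ℂ))
    (fun p => ((A p.Z p.inner : ℝ) : ℂ))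
  have h' : ∑ t ∈ termLabels G D k X n, |(B13StepTermFamily.rhoT (touchInc G) (fun i => (t i).Z) : ℝ)| /
      ((n + 1).factorial : ℝ) * ∏ i, A (t i).Z (t i).inner =
      ∑ Z ∈ polyTuples G k X n, |(B13StepTermFamily.rhoT (touchInc G) Z : ℝ)| / ((n + 1).factorial : ℝ) *
        ∏ i, ∑ ℓ ∈ innerLabels D k (Z i), A (Z i) ℓ := by exact_mod_cast h
  rw [← show ∑ t ∈ termLabels G D k X n, |(B13StepTermFamily.rhoT (touchInc G) (fun i => (t i).Z) : ℝ)| /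
      ((n + 1).factorial : ℝ) * ∏ i, A (t i).Z (t i).inner =
      ∑ t ∈ termLabels G D k X n, actMajorant (labelsIndexing G D) (touchInc G) A k X ⟨n, t⟩ from
    sum_congr rfl fun t ht => by
      rw [actMajorant_of_rel ((rel_iff G D).2 ⟨hX, (mem_termLabels G D).1 ht⟩), norm_coeff_eq]
      rfl]
  exact h'

/-! ## §2 The anchored domination of the level sums by part 2 -/

/-- [folklore] **THE LEVEL BOUND**: `Σ_{Z⃗ covers X} (|ρᵀ(Z⃗)|/(n+1)!)·Π_m actSum(Z_m) ≤ Φ·(4νΦ)^n` — anchor a cube `q₀` of `X`; every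
covering tuple has a member containing `q₀`; restrict the polymers to the finite step-`k` catalogue and apply part 2's
`sum_abs_rhoT_prod_le` at each of the `n + 1` positions. -/
theorem level_le (reach : C.Dom → Finset Cube) {ν Φ : ℝ} (hA : ∀ Z ℓ, 0 ≤ A Z ℓ)
    (hloc : ∀ Z Z', touchInc G Z' Z → ∃ q ∈ reach Z, q ∈ G.cubes Z') (hν : 0 ≤ ν)
    (hreach : ∀ Z, ((reach Z).card : ℝ) ≤ ν * (G.cubes Z).card) (hΦ0 : 0 ≤ Φ) {k : ℕ}
    (hΦ : ∀ q : Cube, ∑ Z ∈ G.level k, ind (q ∈ G.cubes Z) * actSum D A k Z * Real.exp ((G.cubes Z).card) ≤ Φ)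
    {X : C.Dom} (hX : C.scale X = k) (n : ℕ) :
    ∑ Z ∈ polyTuples G k X n, |(B13StepTermFamily.rhoT (touchInc G) Z : ℝ)| / ((n + 1).factorial : ℝ) *
        ∏ m, actSum D A k (Z m) ≤ levelMajorant ν Φ n := by
  -- the finite catalogue of step-`k` domains and the anchor cube
  set L : Finset C.Dom := G.level k with hL
  have hXL : X ∈ L := (G.mem_level X k).2 hX
  obtain ⟨q₀, hq₀⟩ := G.cubes_nonempty X
  -- transported data on the subtype `↥L`
  let cubes' : ↥L → Finset Cube := fun p => G.cubes p.1
  let reach' : ↥L → Finset Cube := fun p => reach p.1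
  let inc' : ↥L → ↥L → Prop := fun a b => touchInc G a.1 b.1
  let w' : ↥L → ℝ := fun p => actSum D A k p.1
  have hsymm' : ∀ a b : ↥L, inc' a b → inc' b a := fun a b h => G.touch_symm _ _ h
  have hloc' : ∀ a b : ↥L, inc' b a → ∃ q ∈ reach' a, q ∈ cubes' b := fun a b h => hloc a.1 b.1 h
  have hreach' : ∀ a : ↥L, ((reach' a).card : ℝ) ≤ ν * (cubes' a).card := fun a => hreach a.1
  have hw' : ∀ a : ↥L, 0 ≤ w' a := fun a => actSum_nonneg D A hA k a.1
  have hΦ' : ∀ q : Cube, ∑ p : ↥L, ind (q ∈ cubes' p) * w' p * Real.exp ((cubes' p).card) ≤ Φ := by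
    intro q
    have := hΦ q
    rwa [← Finset.sum_coe_sort L] at this
  -- the lift of a tuple of domains into the catalogue (frozen at `X` off the catalogue — never used there)
  let lift : (Fin (n + 1) → C.Dom) → (Fin (n + 1) → ↥L) := fun Z m => if h : Z m ∈ L then ⟨Z m, h⟩ else ⟨X, hXL⟩
  have hlift : ∀ Z ∈ polyTuples G k X n, ∀ m, (lift Z m).1 = Z m := by
    intro Z hZ m
    have hm : Z m ∈ L := ((mem_polyTuples G).1 hZ).1 m |>.1
    simp only [lift, dif_pos hm]
  have hinj : Set.InjOn lift (polyTuples G k X n : Set (Fin (n + 1) → C.Dom)) := by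
    intro Z hZ Z' hZ' hZZ'
    funext m
    rw [← hlift Z hZ m, ← hlift Z' hZ' m, hZZ']
  -- the dominating function on the catalogue tuples: anchored at SOME position
  let g : (Fin (n + 1) → ↥L) → ℝ := fun Z' => (∑ m : Fin (n + 1), ind (q₀ ∈ cubes' (Z' m))) *
    (|(B13StepTermFamily.rhoT inc' Z' : ℝ)| / ((n + 1).factorial : ℝ) * ∏ m, w' (Z' m))
  have hg0 : ∀ Z', 0 ≤ g Z' := fun Z' => mul_nonneg (sum_nonneg fun _ _ => ind_nonneg _)
    (mul_nonneg (div_nonneg (abs_nonneg _) (Nat.cast_nonneg _)) (prod_nonneg fun _ _ => hw' _))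
  have hfac : (0 : ℝ) < (n + 1).factorial := by exact_mod_cast Nat.factorial_pos _
  -- step 1: domination tuple by tuple
  have hdom : ∀ Z ∈ polyTuples G k X n,
      |(B13StepTermFamily.rhoT (touchInc G) Z : ℝ)| / ((n + 1).factorial : ℝ) * ∏ m, actSum D A k (Z m) ≤ g (lift Z) := by
    intro Z hZ
    have hρ : B13StepTermFamily.rhoT inc' (lift Z) = B13StepTermFamily.rhoT (touchInc G) Z := by
      unfold B13StepTermFamily.rhoT
      refine Literature.Probability.LatticeModels.hcUrsell_congr fun m _ m' _ => ?_
      show touchInc G (lift Z m).1 (lift Z m').1 ↔ touchInc G (Z m) (Z m')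
      rw [hlift Z hZ m, hlift Z hZ m']
    have hprod : ∏ m, w' (lift Z m) = ∏ m, actSum D A k (Z m) := by
      refine prod_congr rfl fun m _ => ?_
      show actSum D A k (lift Z m).1 = actSum D A k (Z m)
      rw [hlift Z hZ m]
    -- some member contains the anchor
    have hcov : (Finset.univ.biUnion fun m => G.cubes (Z m)) = G.cubes X := ((mem_polyTuples G).1 hZ).2
    have hq : q₀ ∈ Finset.univ.biUnion fun m => G.cubes (Z m) := by rw [hcov]; exact hq₀
    obtain ⟨m₀, -, hm₀⟩ := mem_biUnion.1 hq
    have hone : (1 : ℝ) ≤ ∑ m : Fin (n + 1), ind (q₀ ∈ cubes' (lift Z m)) := by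
      have hmem : q₀ ∈ cubes' (lift Z m₀) := by
        show q₀ ∈ G.cubes (lift Z m₀).1
        rw [hlift Z hZ m₀]
        exact hm₀
      rw [← ind_of_pos hmem]
      exact single_le_sum (f := fun m => ind (q₀ ∈ cubes' (lift Z m))) (fun m _ => ind_nonneg _) (mem_univ m₀)
    have hrest : 0 ≤ |(B13StepTermFamily.rhoT inc' (lift Z) : ℝ)| / ((n + 1).factorial : ℝ) * ∏ m, w' (lift Z m) :=
      mul_nonneg (div_nonneg (abs_nonneg _) (Nat.cast_nonneg _)) (prod_nonneg fun _ _ => hw' _)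
    calc |(B13StepTermFamily.rhoT (touchInc G) Z : ℝ)| / ((n + 1).factorial : ℝ) * ∏ m, actSum D A k (Z m)
        = 1 * (|(B13StepTermFamily.rhoT inc' (lift Z) : ℝ)| / ((n + 1).factorial : ℝ) * ∏ m, w' (lift Z m)) := by
          rw [hρ, hprod, one_mul]
      _ ≤ g (lift Z) := mul_le_mul_of_nonneg_right hone hrest
  -- step 2: sum of the dominating function = Σ_m of the anchored sums of part 2
  have hsumg : ∑ Z' : Fin (n + 1) → ↥L, g Z' ≤ ((n + 1 : ℕ) : ℝ) * (Φ ^ (n + 1) * ν ^ n * ((n.factorial : ℝ) * 4 ^ n)) /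
      ((n + 1).factorial : ℝ) := by
    have hswap : ∑ Z' : Fin (n + 1) → ↥L, g Z' = (∑ m : Fin (n + 1), ∑ Z' : Fin (n + 1) → ↥L,
        ind (q₀ ∈ cubes' (Z' m)) * |(B13StepTermFamily.rhoT inc' Z' : ℝ)| * ∏ m', w' (Z' m')) / ((n + 1).factorial : ℝ) := by
      rw [sum_comm, sum_div]
      refine sum_congr rfl fun Z' _ => ?_
      simp only [g, sum_mul, sum_div]
      exact sum_congr rfl fun m _ => by ring
    rw [hswap]
    refine div_le_div_of_nonneg_right ?_ hfac.le
    calc ∑ m : Fin (n + 1), ∑ Z' : Fin (n + 1) → ↥L,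
          ind (q₀ ∈ cubes' (Z' m)) * |(B13StepTermFamily.rhoT inc' Z' : ℝ)| * ∏ m', w' (Z' m')
        ≤ ∑ _m : Fin (n + 1), Φ ^ (n + 1) * ν ^ n * ((n.factorial : ℝ) * 4 ^ n) :=
          sum_le_sum fun m _ => sum_abs_rhoT_prod_le cubes' reach' inc' w' hsymm' hloc' hν hreach' hw' hΦ0 hΦ' m q₀
      _ = ((n + 1 : ℕ) : ℝ) * (Φ ^ (n + 1) * ν ^ n * ((n.factorial : ℝ) * 4 ^ n)) := by
          rw [sum_const, card_univ, Fintype.card_fin, nsmul_eq_mul]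
  -- step 3: assemble
  calc ∑ Z ∈ polyTuples G k X n, |(B13StepTermFamily.rhoT (touchInc G) Z : ℝ)| / ((n + 1).factorial : ℝ) *
        ∏ m, actSum D A k (Z m)
      ≤ ∑ Z' ∈ (univ : Finset (Fin (n + 1) → ↥L)), g Z' :=
        sum_le_sum_of_injOn_real lift hinj (fun _ _ => mem_univ _) (fun Z' _ => hg0 Z') hdom
    _ ≤ ((n + 1 : ℕ) : ℝ) * (Φ ^ (n + 1) * ν ^ n * ((n.factorial : ℝ) * 4 ^ n)) / ((n + 1).factorial : ℝ) := hsumg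
    _ = levelMajorant ν Φ n := by
        rw [levelMajorant, div_eq_iff hfac.ne', Nat.factorial_succ]
        push_cast
        ring

/-! ## §3 Binder (ii) of row O1-d3 as a theorem: summability and the per-domain budget (decay rate 0) -/

/-- [folklore] `actMajorant` of the socket instance vanishes at a level-`n` label not in the catalogue `termLabels k X n`. -/
theorem actMajorant_eq_zero_of_not_mem {k : ℕ} {X : C.Dom} {n : ℕ} {t : Fin (n + 1) → PolyLabel C.Dom Bnd}
    (ht : t ∉ termLabels G D k X n) : actMajorant (labelsIndexing G D) (touchInc G) A k X ⟨n, t⟩ = 0 :=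
  actMajorant_of_not_rel fun h => ht ((mem_termLabels G D).2 ((rel_iff G D).1 h).2)

/-- [folklore] **BINDER (ii) OF ROW O1-d3, SUMMABILITY**: for the socket instance on Bałaban's term labels, the combinatorial majorant
`actMajorant (labelsIndexing G D) (touchInc G) A k X` is SUMMABLE over the whole term index, from the activity-level anchored
exponential norm `Φ` on the step-`k` catalogue with `4νΦ < 1`. -/
theorem summable_actMajorant (reach : C.Dom → Finset Cube) {ν Φ : ℝ} (hA : ∀ Z ℓ, 0 ≤ A Z ℓ)
    (hloc : ∀ Z Z', touchInc G Z' Z → ∃ q ∈ reach Z, q ∈ G.cubes Z') (hν : 0 ≤ ν)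
    (hreach : ∀ Z, ((reach Z).card : ℝ) ≤ ν * (G.cubes Z).card) (hΦ0 : 0 ≤ Φ) (hsmall : 4 * ν * Φ < 1) {k : ℕ}
    (hΦ : ∀ q : Cube, ∑ Z ∈ G.level k, ind (q ∈ G.cubes Z) * actSum D A k Z * Real.exp ((G.cubes Z).card) ≤ Φ)
    (X : C.Dom) : Summable (actMajorant (labelsIndexing G D) (touchInc G) A k X) := by
  have h0 : ∀ i, 0 ≤ actMajorant (labelsIndexing G D) (touchInc G) A k X i := actMajorant_nonneg hA k X
  by_cases hX : C.scale X = k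
  · have hlevel : ∀ n, Summable fun t : Fin (n + 1) → PolyLabel C.Dom Bnd =>
        actMajorant (labelsIndexing G D) (touchInc G) A k X ⟨n, t⟩ := fun n =>
      summable_of_ne_finset_zero (s := termLabels G D k X n) fun t ht => actMajorant_eq_zero_of_not_mem G D A ht
    have htsum : ∀ n, ∑' t : Fin (n + 1) → PolyLabel C.Dom Bnd, actMajorant (labelsIndexing G D) (touchInc G) A k X ⟨n, t⟩ ≤
        levelMajorant ν Φ n := by
      intro n
      rw [tsum_eq_sum (s := termLabels G D k X n) fun t ht => actMajorant_eq_zero_of_not_mem G D A ht,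
        level_eq G D A hX n]
      exact level_le G D A reach hA hloc hν hreach hΦ0 hΦ hX n
    refine (summable_sigma_of_nonneg h0).2 ⟨hlevel, ?_⟩
    refine Summable.of_nonneg_of_le (fun n => tsum_nonneg fun t => h0 _) htsum (summable_levelMajorant hν hΦ0 hsmall)
  · have : actMajorant (labelsIndexing G D) (touchInc G) A k X = fun _ => 0 :=
      funext fun i => actMajorant_of_not_rel fun h => hX ((rel_iff G D).1 h).1
    rw [this]
    exact summable_zero

/-- [folklore] **BINDER (ii) OF ROW O1-d3, THE PER-DOMAIN BUDGET (decay rate 0)**: `∑' i, actMajorant … A k X i ≤ Φ/(1 − 4νΦ)` — so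
`B13TermRep.classBound_b13_of_actBound` fires with `κ = 0`, `G = Φ/(1 − 4νΦ)` from the activity majorant alone; the decay factor
`e^{−κ d(X)}` of (2.41) p. 21 requires the displayed geometric step (2.27) and is not extracted here. -/
theorem tsum_actMajorant_le (reach : C.Dom → Finset Cube) {ν Φ : ℝ} (hA : ∀ Z ℓ, 0 ≤ A Z ℓ)
    (hloc : ∀ Z Z', touchInc G Z' Z → ∃ q ∈ reach Z, q ∈ G.cubes Z') (hν : 0 ≤ ν)
    (hreach : ∀ Z, ((reach Z).card : ℝ) ≤ ν * (G.cubes Z).card) (hΦ0 : 0 ≤ Φ) (hsmall : 4 * ν * Φ < 1) {k : ℕ}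
    (hΦ : ∀ q : Cube, ∑ Z ∈ G.level k, ind (q ∈ G.cubes Z) * actSum D A k Z * Real.exp ((G.cubes Z).card) ≤ Φ)
    (X : C.Dom) : ∑' i, actMajorant (labelsIndexing G D) (touchInc G) A k X i ≤ Φ / (1 - 4 * ν * Φ) := by
  have h0 : ∀ i, 0 ≤ actMajorant (labelsIndexing G D) (touchInc G) A k X i := actMajorant_nonneg hA k X
  have hsum := summable_actMajorant G D A reach hA hloc hν hreach hΦ0 hsmall hΦ X
  have hRHS : 0 ≤ Φ / (1 - 4 * ν * Φ) := div_nonneg hΦ0 (by linarith)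
  by_cases hX : C.scale X = k
  · obtain ⟨hlevel, houter⟩ := (summable_sigma_of_nonneg h0).1 hsum
    rw [hsum.tsum_sigma' hlevel, ← tsum_levelMajorant hν hΦ0 hsmall]
    refine Summable.tsum_le_tsum (fun n => ?_) houter (summable_levelMajorant hν hΦ0 hsmall)
    rw [tsum_eq_sum (s := termLabels G D k X n) fun t ht => actMajorant_eq_zero_of_not_mem G D A ht, level_eq G D A hX n]
    exact level_le G D A reach hA hloc hν hreach hΦ0 hΦ hX n
  · have : actMajorant (labelsIndexing G D) (touchInc G) A k X = fun _ => 0 :=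
      funext fun i => actMajorant_of_not_rel fun h => hX ((rel_iff G D).1 h).1
    rw [this, tsum_zero]
    exact hRHS

/-! ## §4 Plugged into row O1-d3 BY NAME (leaf-04's `B13TermRep`, p208307): `TermRep` and `ClassBound` at decay rate 0 -/

section Plug

open Literature.MathematicalPhysics.QuantumFieldTheory.Balaban1983to89.T4InputCauchyRateData (StepModel)
open Literature.MathematicalPhysics.QuantumFieldTheory.Balaban1983to89.T4InputCauchyRateSpecies (ClassBound)
open Literature.MathematicalPhysics.QuantumFieldTheory.Balaban1983to89.T4InputCauchyRateTermwise (TermRep)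
open Summit.QuantumFields.BalabanUV.T4Continuum.B13TermRep (termRep_b13_of_actBound classBound_b13_of_actBound)

variable {Op Hist : Type*} [NormedAddCommGroup Op] [NormedSpace ℂ Op] [NormedAddCommGroup Hist] [NormedSpace ℂ Hist]

/-- [folklore] **ROW O1-d3 (`TermRep`) FOR THE SOCKET INSTANCE FROM THE ACTIVITY MAJORANT ALONE.**  For a step model whose output is
the B13 series on Bałaban's term labels (`M.Out = out (labelsIndexing G D) (touchInc G) act`), leaf-04's displayed binder (i) — an
activity majorant `𝒜 k g U` of the (2.14)-terms at the class points, the SHAPE of [Balaban1988RG2Cluster] Lemma 3 (2.38) p. 20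
(displayed, locator only) — together with its anchored exponential norm `Φ`, `4νΦ < 1`, on every step catalogue GIVES
`TermRep M K (term …) W`: binder (ii) `hconv` of `B13TermRep.termRep_b13_of_actBound` is `summable_actMajorant`. -/
theorem termRep_b13_of_actNorm (act : C.Dom → InnerLabel C.Dom Bnd → Op → Hist → ℂ) {M : StepModel C Op Hist}
    (hM : ∀ k o h X, M.Out k o h X = B13StepTermFamily.out (labelsIndexing G D) (touchInc G) act k o h X)
    {K : ℕ → (ℕ → ℝ) → C.BgB → Set (Op × Hist)} {W : Set (ℕ → ℝ)} {𝒜 : ℕ → (ℕ → ℝ) → C.BgB → C.Dom → InnerLabel C.Dom Bnd → ℝ}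
    (hA : ∀ k, ∀ g ∈ W, ∀ (U : C.BgB) (q : Op × Hist), q ∈ K k g U → ∀ X : C.Dom, C.scale X = k →
      ∀ i, (labelsIndexing G D).Rel k i X → ∀ m, ‖act ((labelsIndexing G D).poly i m) ((labelsIndexing G D).lab i m) q.1 q.2‖ ≤
        𝒜 k g U ((labelsIndexing G D).poly i m) ((labelsIndexing G D).lab i m))
    (hA0 : ∀ k g U Z ℓ, 0 ≤ 𝒜 k g U Z ℓ) (reach : C.Dom → Finset Cube) {ν Φ : ℝ}
    (hloc : ∀ Z Z', touchInc G Z' Z → ∃ q ∈ reach Z, q ∈ G.cubes Z') (hν : 0 ≤ ν)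
    (hreach : ∀ Z, ((reach Z).card : ℝ) ≤ ν * (G.cubes Z).card) (hΦ0 : 0 ≤ Φ) (hsmall : 4 * ν * Φ < 1)
    (hΦ : ∀ k, ∀ g ∈ W, ∀ (U : C.BgB) (q : Cube),
      ∑ Z ∈ G.level k, ind (q ∈ G.cubes Z) * actSum D (𝒜 k g U) k Z * Real.exp ((G.cubes Z).card) ≤ Φ) :
    TermRep M K (B13StepTermFamily.term (labelsIndexing G D) (touchInc G) act) W :=
  termRep_b13_of_actBound (labelsIndexing G D) (touchInc G) act hM hA fun k g hg U X _ =>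
    summable_actMajorant G D (𝒜 k g U) reach (hA0 k g U) hloc hν hreach hΦ0 hsmall (hΦ k g hg U) X

/-- [folklore] **ROW O1-d3 (`ClassBound`, decay rate 0) FOR THE SOCKET INSTANCE FROM THE ACTIVITY MAJORANT ALONE**: the same data GIVE
`ClassBound M K W 0 (Φ/(1 − 4νΦ))` — binder (iii) `hbud` of `B13TermRep.classBound_b13_of_actBound` at `κ = 0` is
`summable_actMajorant ∧ tsum_actMajorant_le`.  (The rate `κ > 0` of (2.41) p. 21 is the displayed geometric step (2.27), not here.) -/
theorem classBound_b13_of_actNorm (act : C.Dom → InnerLabel C.Dom Bnd → Op → Hist → ℂ) {M : StepModel C Op Hist}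
    (hM : ∀ k o h X, M.Out k o h X = B13StepTermFamily.out (labelsIndexing G D) (touchInc G) act k o h X)
    {K : ℕ → (ℕ → ℝ) → C.BgB → Set (Op × Hist)} {W : Set (ℕ → ℝ)} {𝒜 : ℕ → (ℕ → ℝ) → C.BgB → C.Dom → InnerLabel C.Dom Bnd → ℝ}
    (hA : ∀ k, ∀ g ∈ W, ∀ (U : C.BgB) (q : Op × Hist), q ∈ K k g U → ∀ X : C.Dom, C.scale X = k →
      ∀ i, (labelsIndexing G D).Rel k i X → ∀ m, ‖act ((labelsIndexing G D).poly i m) ((labelsIndexing G D).lab i m) q.1 q.2‖ ≤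
        𝒜 k g U ((labelsIndexing G D).poly i m) ((labelsIndexing G D).lab i m))
    (hA0 : ∀ k g U Z ℓ, 0 ≤ 𝒜 k g U Z ℓ) (reach : C.Dom → Finset Cube) {ν Φ : ℝ}
    (hloc : ∀ Z Z', touchInc G Z' Z → ∃ q ∈ reach Z, q ∈ G.cubes Z') (hν : 0 ≤ ν)
    (hreach : ∀ Z, ((reach Z).card : ℝ) ≤ ν * (G.cubes Z).card) (hΦ0 : 0 ≤ Φ) (hsmall : 4 * ν * Φ < 1)
    (hΦ : ∀ k, ∀ g ∈ W, ∀ (U : C.BgB) (q : Cube),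
      ∑ Z ∈ G.level k, ind (q ∈ G.cubes Z) * actSum D (𝒜 k g U) k Z * Real.exp ((G.cubes Z).card) ≤ Φ) :
    ClassBound M K W 0 (Φ / (1 - 4 * ν * Φ)) :=
  classBound_b13_of_actBound hM hA fun k g hg U X _ =>
    ⟨summable_actMajorant G D (𝒜 k g U) reach (hA0 k g U) hloc hν hreach hΦ0 hsmall (hΦ k g hg U) X, by
      rw [zero_mul, neg_zero, Real.exp_zero, mul_one]
      exact tsum_actMajorant_le G D (𝒜 k g U) reach (hA0 k g U) hloc hν hreach hΦ0 hsmall (hΦ k g hg U) X⟩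

end Plug

end Summit.QuantumFields.BalabanUV.T4Continuum.UrsellTermBudget

end
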